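import Literature.Analysis.FluidPDE.NSLerayHopfABCScaling
import Literature.Analysis.FluidPDE.SelfSimilarProofs
import Literature.Analysis.FunctionSpaces.SobolevBallScaling
import HarnessLib

/-!
# The Navier–Stokes scaling of Leray–Hopf weak solutions: discharge of `IsLerayHopfOn.nsRescale`

Analysis/FluidPDE proof file (no named facts). The named fact
`Literature.Analysis.FluidPDE.IsLerayHopfOn.nsRescale` (`SelfSimilar.lean`; Leray 1934, §20:
"si `u(x,t)` est une solution, `λ u(λ x, λ² t)` en est une autre"; Caffarelli–Kohn–Nirenberg 1982,
§1) — *if `u` is a Leray–Hopf weak solution on `E × [0, T)` with force `f` and datum `u₀`, then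
for `0 < c` the parabolic rescaling `nsRescale c u = c u(c² ·, c ·)` is a Leray–Hopf weak solution
on `[0, T/c²)` with force `nsRescaleForce c f = c³ f(c² ·, c ·)` and datum
`nsRescaleData c u₀ = c u₀(c ·)`* — is **proved** here (`IsLerayHopfOn.nsRescale_holds`), field by
field, from the space–time change of variables of `SpaceTimeRescaling.lean`
(`Φ(s, y) = (c² s, c y)`, `dz = c^{2+n} dz'`, `n = dim E`):

* the weak formulation (`IsWeakNSSolutionOn.nsRescale`): test `u` with `ψ ∘ Φ⁻¹`; each term of
  the weak identity for the rescaled triple tested with `ψ` is `c^{1-n}` times the corresponding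
  term for `(u, f, u₀)` tested with `ψ ∘ Φ⁻¹` (chain rules `timeDeriv_stPull`, `convect_stPull`,
  `laplacian_stPull`; substitution `integral_comp_space_affine`, `setIntegral_Ioo_comp_const_mul`);
* the weak gradient rescales to `s y ↦ c² G(c² s)(c y)` (`HasWeakFDerivOn.comp_affine`,
  `HasWeakFDerivOn.const_smul`), and kinetic energy, dissipation and forcing work all pick up the
  common factor `c² c⁻ⁿ` (`energyIneq_nsRescale`), so both energy inequalities are preserved;
* the `L^∞L²` bound, `L²` slices, weak `L²` continuity (pairings against `w` become pairings
  against `w(c⁻¹ ·)`, `integral_inner_nsRescaleData`) and strong attainment of the datum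
  (`eLpNorm_nsRescaleData_of_ne_zero`) are composed with `s ↦ c² s`.

Also recorded, for the users of the scaling (local `H¹` theory with lifespan in terms of
`‖∇u₀‖`, `LerayLocalRegularH1Proofs.lean`): the scaling laws of the slice functionals
`eEnergy (nsRescaleData c w) = c² c⁻ⁿ eEnergy w`, the rescaled weak gradient `x ↦ c² G(c x)` and
its dissipation `c⁴ c⁻ⁿ ∫⁻ |G|²` (`eEnergy_nsRescaleData`, `hasWeakGradient_nsRescaleData`,
`lintegral_frobeniusNormSq_nsRescaleGrad`).

## Mathlib / tree search

Tree: `IsLerayHopfOn.viscosityRescale` / `IsWeakNSSolutionOn.viscosityRescale`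
(`NSLerayHopfABCScaling.lean`, the template: time dilation only), `stPull`, `stAffine`,
`IsSpaceTimeTestOn.stPull_symm`, `timeDeriv_stPull`, `convect_stPull`, `laplacian_stPull`,
`divergence_stPull`, `setLIntegral_enorm_pow_stRescale`, `setLIntegral_frobeniusNormSq_stRescale`,
`integral_comp_space_affine`, `lintegral_comp_space_affine`, `map_space_affine_volume`
(`SpaceTimeRescaling.lean`); `aestronglyMeasurable_comp_stAffine_Ioo`,
`stAffine_preimage_Ioo_prod_univ` (`KatoLocalCovariance.lean`); `HasWeakFDerivOn.comp_affine`
(`SobolevBallScaling.lean`); `HasWeakFDerivOn.const_smul` (`SobolevDomainNormProofs.lean`);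
`IsWeaklyDivFree.nsRescaleData`, `integral_inner_nsRescaleData` (`SelfSimilarProofs.lean`);
`ae_restrict_Ioo_div_comp_mul_left`, `setLIntegral_Ioo_comp_const_mul`,
`setIntegral_Ioo_comp_const_mul`, `tendsto_mul_left_nhdsGT_zero`, `mapsTo_mul_Ioc_div`,
`kineticEnergy_const_smul` (`NSLerayHopfABCScaling.lean`). Mathlib: `Measure.map_addHaar_smul`,
`MeasurableEmbedding.eLpNorm_map_measure`, `MeasurableEmbedding.memLp_map_measure_iff`,
`Measure.integral_comp_smul`, `intervalIntegral.smul_integral_comp_mul_left`.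

## References

* J. Leray, *Sur le mouvement d'un liquide visqueux emplissant l'espace*, Acta Math. 63 (1934),
  §20 (the similarity transformation `λ u(λx, λ²t)`). [Leray1934]
* L. Caffarelli, R. Kohn, L. Nirenberg, CPAM 35 (1982), §1 (1.5)–(1.6) (scaling of weak
  solutions and of the energy inequality). [CaffarelliKohnNirenberg1982]
-/

noncomputable section

open MeasureTheory TopologicalSpace Set Function Filter
open _root_.Topology
open scoped InnerProductSpace RealInnerProductSpace ENNReal NNReal Laplacian

namespace Literature.Analysis.FluidPDE

/-! ### Bookkeeping: the parabolic scaling as a pull-back along `Φ(s, y) = (c² s, c y)` -/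

section Bookkeeping

variable {E : Type*} [NormedAddCommGroup E] [InnerProductSpace ℝ E]
variable {F : Type*} [NormedAddCommGroup F] [NormedSpace ℝ F]

/-- `nsRescale c u = c • u ∘ Φ` with `Φ(s, y) = (c² s, c y)`. [folklore] -/
theorem nsRescale_eq_smul_stPull (c : ℝ) (u : ℝ → E → F) :
    nsRescale c u = c • stPull (c ^ 2) c 0 (0 : E) u := by
  funext s y
  rw [nsRescale_apply, smul_stPull_apply, zero_add, zero_add]

/-- `nsRescaleForce c f = c³ • f ∘ Φ` with `Φ(s, y) = (c² s, c y)`. [folklore] -/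
theorem nsRescaleForce_eq_smul_stPull (c : ℝ) (f : ℝ → E → F) :
    nsRescaleForce c f = (c ^ 3) • stPull (c ^ 2) c 0 (0 : E) f := by
  funext s y
  rw [nsRescaleForce_apply, smul_stPull_apply, zero_add, zero_add]

/-- Slices of the rescaled field are rescaled slices: `(nsRescale c u) s = nsRescaleData c (u (c² s))`. [folklore] -/
theorem nsRescale_slice (c : ℝ) (u : ℝ → E → F) (s : ℝ) :
    nsRescale c u s = nsRescaleData c (u (c ^ 2 * s)) := rfl

/-- The pull-back of the open slab `(-∞, T) × E` along `Φ(s, y) = (β s, x₀ + γ y)` (`β > 0`) is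
the slab `(-∞, T/β) × E` (the slab constrains only the time variable). [folklore] -/
theorem stPreimage_slab_Iio_of_pos {β : ℝ} (hβ : 0 < β) (γ : ℝ) (x₀ : E) (T : ℝ) :
    stPreimage β γ 0 x₀ (slab E (Iio T) isOpen_Iio) = slab E (Iio (T / β)) isOpen_Iio := by
  ext z
  simp only [coe_stPreimage, mem_preimage, SetLike.mem_coe, mem_slab, stAffine_fst, zero_add,
    mem_Iio]
  rw [lt_div_iff₀ hβ, mul_comm]

/-- `Φ⁻¹((0, T) × γK) = (0, T/β) × K` for `Φ(s, y) = (β s, γ y)`, `β > 0`, `γ ≠ 0`. [folklore] -/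
theorem stAffine_preimage_Ioo_prod_image_smul {β : ℝ} (hβ : 0 < β) {γ : ℝ} (hγ : γ ≠ 0) (T : ℝ)
    (K : Set E) :
    stAffine β γ 0 (0 : E) ⁻¹' (Ioo 0 T ×ˢ ((fun y : E => γ • y) '' K)) = Ioo 0 (T / β) ×ˢ K := by
  ext ⟨s, y⟩
  simp only [mem_preimage, stAffine_apply, zero_add, mem_prod, mul_mem_Ioo_zero_iff_mem_Ioo_div hβ]
  refine and_congr Iff.rfl ⟨?_, fun hy => ⟨y, hy, rfl⟩⟩
  rintro ⟨y', hy', hyy'⟩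
  have : y' = y := smul_right_injective E hγ hyy'
  rwa [← this]

end Bookkeeping

/-! ### Space dilation of the slice functionals -/

section Slices

variable {E : Type*} [NormedAddCommGroup E] [InnerProductSpace ℝ E] [FiniteDimensional ℝ E]
  [MeasurableSpace E] [BorelSpace E]
variable {F : Type*} [NormedAddCommGroup F] [NormedSpace ℝ F]

/-- `∫⁻ ‖c w(c x)‖ₑ² dx = c² (cⁿ)⁻¹ ∫⁻ ‖w‖ₑ²` (`c > 0`, `n = dim E`). [folklore] -/
theorem lintegral_enorm_sq_nsRescaleData {c : ℝ} (hc : 0 < c) (w : E → F) :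
    ∫⁻ x, ‖nsRescaleData c w x‖ₑ ^ 2 =
      ENNReal.ofReal (c ^ 2) * ENNReal.ofReal (c ^ Module.finrank ℝ E)⁻¹ * ∫⁻ x, ‖w x‖ₑ ^ 2 := by
  have h1 : ∀ x, ‖nsRescaleData c w x‖ₑ ^ 2 =
      ENNReal.ofReal (c ^ 2) * (fun y => ‖w y‖ₑ ^ 2) ((0 : E) + c • x) := by
    intro x
    rw [nsRescaleData_apply, zero_add, enorm_smul, mul_pow, Real.enorm_eq_ofReal hc.le,
      ENNReal.ofReal_pow hc.le]
  simp_rw [h1]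
  rw [lintegral_const_mul' _ _ ENNReal.ofReal_ne_top,
    lintegral_comp_space_affine hc (0 : E) (fun y => ‖w y‖ₑ ^ 2), mul_assoc]

/-- **Scaling of the extended energy**: `eEnergy (c w(c ·)) = c² (cⁿ)⁻¹ eEnergy w`. [folklore] -/
theorem eEnergy_nsRescaleData {c : ℝ} (hc : 0 < c) (w : E → F) :
    eEnergy (nsRescaleData c w) =
      ENNReal.ofReal (c ^ 2) * ENNReal.ofReal (c ^ Module.finrank ℝ E)⁻¹ * eEnergy w :=
  lintegral_enorm_sq_nsRescaleData hc w

/-- **Scaling of `L^p` norms**: `‖c w(c ·)‖_{L^p} = ‖c‖ₑ |c⁻ⁿ|^{1/p} ‖w‖_{L^p}` (`c ≠ 0`; for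
`p = ∞` the middle factor is `1`). [folklore] -/
theorem eLpNorm_nsRescaleData_of_ne_zero (p : ℝ≥0∞) (w : E → F) {c : ℝ} (hc : c ≠ 0) :
    eLpNorm (nsRescaleData c w) p volume =
      ‖c‖ₑ * ENNReal.ofReal |(c ^ Module.finrank ℝ E)⁻¹| ^ (1 / p).toReal * eLpNorm w p volume := by
  have hemb : MeasurableEmbedding (fun x : E => c • x) :=
    (Homeomorph.smul (Units.mk0 c hc)).measurableEmbedding
  have h0 : ENNReal.ofReal |(c ^ Module.finrank ℝ E)⁻¹| ≠ 0 :=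
    (ENNReal.ofReal_pos.2 (abs_pos.2 (inv_ne_zero (pow_ne_zero _ hc)))).ne'
  have h1 : nsRescaleData c w = c • (w ∘ fun x : E => c • x) := by
    funext x; rfl
  rw [h1, eLpNorm_const_smul, ← hemb.eLpNorm_map_measure, Measure.map_addHaar_smul volume hc,
    eLpNorm_smul_measure_of_ne_zero h0, smul_eq_mul, mul_assoc]

/-- **`L^p` slices stay `L^p`**: `w ∈ L^p ⇒ c w(c ·) ∈ L^p` (`c ≠ 0`). [folklore] -/
theorem memLp_nsRescaleData {p : ℝ≥0∞} {w : E → F} (hw : MemLp w p volume) {c : ℝ} (hc : c ≠ 0) :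
    MemLp (nsRescaleData c w) p volume := by
  have h1 : MemLp w p (Measure.map (fun x : E => c • x) volume) := by
    rw [Measure.map_addHaar_smul volume hc]
    exact hw.smul_measure ENNReal.ofReal_ne_top
  have h2 : MemLp (fun x => w (c • x)) p volume :=
    h1.comp_of_map (measurable_const_smul _).aemeasurable
  exact h2.const_smul c

omit [NormedSpace ℝ F] in
/-- `w ∈ L^p ⇒ w(c ·) ∈ L^p` (`c ≠ 0`). [folklore] -/
theorem memLp_comp_smul_of_ne_zero {p : ℝ≥0∞} {w : E → F} (hw : MemLp w p volume) {c : ℝ}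
    (hc : c ≠ 0) : MemLp (fun x => w (c • x)) p volume := by
  have h1 : MemLp w p (Measure.map (fun x : E => c • x) volume) := by
    rw [Measure.map_addHaar_smul volume hc]
    exact hw.smul_measure ENNReal.ofReal_ne_top
  exact h1.comp_of_map (measurable_const_smul _).aemeasurable

/-- **Scaling of the kinetic energy**: `E(c w(c ·)) = c² (cⁿ)⁻¹ E(w)` (`c > 0`). [folklore] -/
theorem kineticEnergy_nsRescaleData {c : ℝ} (hc : 0 < c) (w : E → F) :
    VectorCalculus.kineticEnergy (nsRescaleData c w) =
      c ^ 2 * (c ^ Module.finrank ℝ E)⁻¹ * VectorCalculus.kineticEnergy w := by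
  unfold VectorCalculus.kineticEnergy
  have h1 : (fun x => ‖nsRescaleData c w x‖ ^ 2) = fun x => (fun y => c ^ 2 * ‖w y‖ ^ 2) (c • x) := by
    funext x
    rw [nsRescaleData_apply, norm_smul, mul_pow, Real.norm_eq_abs, sq_abs]
  rw [h1, Measure.integral_comp_smul volume (fun y => c ^ 2 * ‖w y‖ ^ 2) c, integral_const_mul,
    smul_eq_mul, abs_of_nonneg (inv_nonneg.2 (pow_nonneg hc.le _))]
  ring

/-- **Weak gradients under the space dilation**: if `G` is a weak gradient of `w`, then
`x ↦ c² G(c x)` is a weak gradient of `c w(c ·)` (`c > 0`; chain rule on the test function and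
the substitution `y = c x`). [folklore] -/
theorem hasWeakGradient_nsRescaleData {F' : Type*} [NormedAddCommGroup F'] [InnerProductSpace ℝ F']
    {w : E → F'} {G : E → E →L[ℝ] F'} (h : HasWeakGradient w G) {c : ℝ} (hc : 0 < c) :
    HasWeakGradient (nsRescaleData c w) (fun x => c ^ 2 • G (c • x)) := by
  have h1 := (FunctionSpaces.HasWeakFDerivOn.comp_affine hc (0 : E) h).const_smul c
  have hpre : FunctionSpaces.affinePreimage c (0 : E) (⊤ : Opens E) = ⊤ := by
    ext y; simp
  rw [hpre] at h1
  have e1 : c • (fun y : E => w (0 + c • y)) = nsRescaleData c w := by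
    funext y; simp [nsRescaleData_apply]
  have e2 : c • (fun y : E => c • G (0 + c • y)) = fun x => c ^ 2 • G (c • x) := by
    funext y; simp [smul_smul, sq]
  rw [e1, e2] at h1
  exact h1

/-- The dissipation density of the rescaled gradient: `∫⁻ |c² G(c ·)|² = c⁴ (cⁿ)⁻¹ ∫⁻ |G|²`. [folklore] -/
theorem lintegral_frobeniusNormSq_nsRescaleGrad {F' : Type*} [NormedAddCommGroup F']
    [InnerProductSpace ℝ F'] {c : ℝ} (hc : 0 < c) (G : E → E →L[ℝ] F') :
    ∫⁻ x, ENNReal.ofReal (frobeniusNormSq (c ^ 2 • G (c • x))) =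
      ENNReal.ofReal (c ^ 4) * ENNReal.ofReal (c ^ Module.finrank ℝ E)⁻¹ *
        ∫⁻ x, ENNReal.ofReal (frobeniusNormSq (G x)) := by
  have h1 : ∀ x, ENNReal.ofReal (frobeniusNormSq (c ^ 2 • G (c • x))) =
      ENNReal.ofReal (c ^ 4) *
        (fun y => ENNReal.ofReal (frobeniusNormSq (G y))) ((0 : E) + c • x) := by
    intro x
    rw [zero_add, frobeniusNormSq_smul, ENNReal.ofReal_mul (sq_nonneg _)]
    congr 2
    ring
  simp_rw [h1]
  rw [lintegral_const_mul' _ _ ENNReal.ofReal_ne_top,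
    lintegral_comp_space_affine hc (0 : E) (fun y => ENNReal.ofReal (frobeniusNormSq (G y))),
    mul_assoc]

end Slices

/-! ### The weak formulation under the parabolic scaling -/

section Weak

variable {E : Type*} [NormedAddCommGroup E] [InnerProductSpace ℝ E] [FiniteDimensional ℝ E]
  [MeasurableSpace E] [BorelSpace E]

/-- **The Navier–Stokes scaling of weak solutions.** If `u` is a weak solution on `E × [0, T)`
with viscosity `ν`, force `f` and datum `u₀`, then for `c > 0` the field `c u(c² ·, c ·)` is a
weak solution on `[0, T/c²)` with the same viscosity, force `c³ f(c² ·, c ·)` and datum `c u₀(c ·)`: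
against a divergence-free test field `ψ` on `(-∞, T/c²) × E` one tests `u` with `ψ ∘ Φ⁻¹`,
`Φ(s, y) = (c² s, c y)`; after the substitution `(t, x) = Φ(s, y)` every term of the weak identity
is `c^{1-n}` times the corresponding term for `u` (Leray 1934, §20; Caffarelli–Kohn–Nirenberg
1982, §1). [cite: Leray1934, §20] -/
theorem IsWeakNSSolutionOn.nsRescale {T ν : ℝ} {f u : ℝ → E → E} {u₀ : E → E}
    (h : IsWeakNSSolutionOn T ν f u₀ u) {c : ℝ} (hc : 0 < c) :
    IsWeakNSSolutionOn (T / c ^ 2) ν (nsRescaleForce c f) (nsRescaleData c u₀)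
      (FluidPDE.nsRescale c u) := by
  have hc2 : 0 < c ^ 2 := by positivity
  have hc0 : c ≠ 0 := hc.ne'
  obtain ⟨hmeas, hloc, hdiv, hweak⟩ := h
  refine ⟨?_, fun K hK => ?_, ?_, fun ψ hψ hψdiv => ?_⟩
  · -- measurability on the slab `(0, T/c²) × E`
    have h1 := aestronglyMeasurable_comp_stAffine_Ioo hc2 hc (0 : E) hmeas
    have h2 : uncurry (FluidPDE.nsRescale c u) =
        fun z => c • (uncurry u ∘ stAffine (c ^ 2) c 0 (0 : E)) z := by
      funext z
      obtain ⟨s, y⟩ := z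
      simp [stAffine, nsRescale_apply]
    rw [h2]
    exact h1.const_smul c
  · -- local square integrability up to the time boundary
    have h1 := setLIntegral_enorm_pow_stRescale hc2 hc 0 (0 : E) c u
      (Ioo 0 T ×ˢ ((fun y : E => c • y) '' K)) 2
    rw [stAffine_preimage_Ioo_prod_image_smul hc2 hc0, ← nsRescale_eq_smul_stPull] at h1
    calc ∫⁻ z in Ioo 0 (T / c ^ 2) ×ˢ K, ‖uncurry (FluidPDE.nsRescale c u) z‖ₑ ^ 2
        = ‖c‖ₑ ^ 2 * ENNReal.ofReal (c ^ 2 * c ^ Module.finrank ℝ E)⁻¹ *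
            ∫⁻ z in Ioo 0 T ×ˢ ((fun y : E => c • y) '' K), ‖u z.1 z.2‖ₑ ^ 2 := h1
      _ < ∞ := ENNReal.mul_lt_top (ENNReal.mul_lt_top (ENNReal.pow_lt_top enorm_lt_top)
          ENNReal.ofReal_lt_top) (hloc _ (hK.image (continuous_const_smul c)))
  · -- weak divergence-freeness of a.e. slice
    filter_upwards [ae_restrict_Ioo_div_comp_mul_left hc2 T hdiv] with s hs
    rw [nsRescale_slice]
    exact hs.nsRescaleData hc
  · -- the weak identity: test `u` with `ψ ∘ Φ⁻¹`
    rw [← stPreimage_slab_Iio_of_pos hc2 c (0 : E) T] at hψ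
    set ψ' := stPull (c ^ 2)⁻¹ c⁻¹ (-((c ^ 2)⁻¹ * 0)) (-(c⁻¹ • (0 : E))) ψ with hψ'_def
    have hψ'Q : IsSpaceTimeTestOn (slab E (Iio T) isOpen_Iio) ψ' := hψ.stPull_symm hc2.ne' hc0
    have hrepr : ψ = stPull (c ^ 2) c 0 0 ψ' := (stPull_stPull_symm hc2.ne' hc0 0 0 ψ).symm
    have hdiv' : ∀ t, VectorCalculus.IsDivFree (ψ' t) := by
      intro t x
      have h0 := hψdiv (-((c ^ 2)⁻¹ * 0) + (c ^ 2)⁻¹ * t) (-(c⁻¹ • (0 : E)) + c⁻¹ • x)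
      rw [hψ'_def, divergence_stPull, h0, mul_zero]
    have hid := hweak ψ' hψ'Q hdiv'
    set I : ℝ → E → ℝ := fun t x => ⟪u t x, timeDeriv ψ' t x⟫ + ⟪u t x, convect (u t) (ψ' t) x⟫ +
      ν * ⟪u t x, Δ (ψ' t) x⟫ + ⟪f t x, ψ' t x⟫ with hI
    have key : ∀ s y, ⟪FluidPDE.nsRescale c u s y, timeDeriv ψ s y⟫ +
        ⟪FluidPDE.nsRescale c u s y, convect (FluidPDE.nsRescale c u s) (ψ s) y⟫ +
        ν * ⟪FluidPDE.nsRescale c u s y, Δ (ψ s) y⟫ + ⟪nsRescaleForce c f s y, ψ s y⟫ =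
        c ^ 3 * I (c ^ 2 * s) (c • y) := by
      intro s y
      conv_lhs => rw [hrepr]
      rw [timeDeriv_stPull, convect_stPull,
        laplacian_stPull _ _ _ _ _ _ _ (hψ'Q.contDiff_slice_two _), stPull_apply, hI]
      simp only [zero_add, nsRescale_apply, nsRescaleForce_apply, map_smul, real_inner_smul_left,
        real_inner_smul_right, convect_apply]
      ring
    have hA : ∫ s in Ioo 0 (T / c ^ 2), ∫ y, (⟪FluidPDE.nsRescale c u s y, timeDeriv ψ s y⟫ +
        ⟪FluidPDE.nsRescale c u s y, convect (FluidPDE.nsRescale c u s) (ψ s) y⟫ +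
        ν * ⟪FluidPDE.nsRescale c u s y, Δ (ψ s) y⟫ + ⟪nsRescaleForce c f s y, ψ s y⟫) =
        c ^ 3 * (c ^ Module.finrank ℝ E)⁻¹ * ((c ^ 2)⁻¹ * ∫ t in Ioo 0 T, ∫ x, I t x) := by
      simp_rw [key]
      have h2 : ∀ s, ∫ y, c ^ 3 * I (c ^ 2 * s) (c • y) =
          c ^ 3 * (c ^ Module.finrank ℝ E)⁻¹ * (fun t => ∫ x, I t x) (c ^ 2 * s) := by
        intro s
        rw [integral_const_mul]
        have e := integral_comp_space_affine hc (0 : E) (I (c ^ 2 * s))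
        simp only [zero_add] at e
        rw [e, smul_eq_mul, mul_assoc]
      simp_rw [h2]
      rw [integral_const_mul]
      have h3 := setIntegral_Ioo_comp_const_mul (fun t => ∫ x, I t x) hc2 0 (T / c ^ 2)
      beta_reduce at h3
      rw [mul_zero, mul_div_cancel_pos hc2] at h3
      rw [h3, smul_eq_mul]
    have hB : ∫ y, ⟪nsRescaleData c u₀ y, ψ 0 y⟫ =
        c ^ 3 * (c ^ Module.finrank ℝ E)⁻¹ * ((c ^ 2)⁻¹ * ∫ x, ⟪u₀ x, ψ' 0 x⟫) := by
      have e : ∀ y, ⟪nsRescaleData c u₀ y, ψ 0 y⟫ =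
          c * (fun x => ⟪u₀ x, ψ' 0 x⟫) ((0 : E) + c • y) := by
        intro y
        conv_lhs => rw [hrepr]
        simp only [nsRescaleData_apply, stPull_apply, mul_zero, add_zero, zero_add,
          real_inner_smul_left]
      simp_rw [e]
      rw [integral_const_mul, integral_comp_space_affine hc (0 : E) (fun x => ⟪u₀ x, ψ' 0 x⟫),
        smul_eq_mul]
      field_simp
    rw [hA, hB, ← mul_add, ← mul_add, hid, mul_zero, mul_zero]

end Weak

/-! ### The energy inequality under the parabolic scaling -/

section Energy

variable {E : Type*} [NormedAddCommGroup E] [InnerProductSpace ℝ E] [FiniteDimensional ℝ E]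
  [MeasurableSpace E] [BorelSpace E]

/-- The dissipation of the rescaled weak gradient `s y ↦ c² G(c² s)(c y)` over `(a, b)`:
`∫_{(a,b)} ∫ |c² G(c² s)(c y)|² = c⁴ (cⁿ)⁻¹ (c²)⁻¹ ∫_{(c²a, c²b)} ∫ |G|²`. [folklore] -/
theorem setLIntegral_frobeniusNormSq_nsRescaleGrad {c : ℝ} (hc : 0 < c) (G : ℝ → E → E →L[ℝ] E)
    (a b : ℝ) :
    ∫⁻ τ in Ioo a b, ∫⁻ x, ENNReal.ofReal (frobeniusNormSq (c ^ 2 • G (c ^ 2 * τ) (c • x))) =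
      ENNReal.ofReal (c ^ 4) * ENNReal.ofReal (c ^ Module.finrank ℝ E)⁻¹ *
        (ENNReal.ofReal (c ^ 2)⁻¹ *
          ∫⁻ τ in Ioo (c ^ 2 * a) (c ^ 2 * b), ∫⁻ x, ENNReal.ofReal (frobeniusNormSq (G τ x))) := by
  have hc2 : 0 < c ^ 2 := by positivity
  have e1 : ∀ τ, ∫⁻ x, ENNReal.ofReal (frobeniusNormSq (c ^ 2 • G (c ^ 2 * τ) (c • x))) =
      ENNReal.ofReal (c ^ 4) * ENNReal.ofReal (c ^ Module.finrank ℝ E)⁻¹ *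
        (fun t => ∫⁻ x, ENNReal.ofReal (frobeniusNormSq (G t x))) (c ^ 2 * τ) := fun τ =>
    lintegral_frobeniusNormSq_nsRescaleGrad hc (G (c ^ 2 * τ))
  simp_rw [e1]
  rw [lintegral_const_mul' _ _ (ENNReal.mul_ne_top ENNReal.ofReal_ne_top ENNReal.ofReal_ne_top),
    setLIntegral_Ioo_comp_const_mul
      (fun t => ∫⁻ x, ENNReal.ofReal (frobeniusNormSq (G t x))) hc2 a b]

/-- The forcing work of the rescaled pair over `(a, b)`:
`∫ₐᵇ ∫ ⟪c³ f(c² s)(c y), c u(c² s)(c y)⟫ = c⁴ (cⁿ)⁻¹ (c²)⁻¹ ∫_{c²a}^{c²b} ∫ ⟪f, u⟫`. [folklore] -/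
theorem intervalIntegral_forcing_nsRescale {c : ℝ} (hc : 0 < c) (f u : ℝ → E → E) (a b : ℝ) :
    ∫ τ in a..b, ∫ x, ⟪nsRescaleForce c f τ x, FluidPDE.nsRescale c u τ x⟫ =
      c ^ 4 * (c ^ Module.finrank ℝ E)⁻¹ *
        ((c ^ 2)⁻¹ * ∫ τ in (c ^ 2 * a)..(c ^ 2 * b), ∫ x, ⟪f τ x, u τ x⟫) := by
  have hc0 : c ≠ 0 := hc.ne'
  have e1 : ∀ τ, ∫ x, ⟪nsRescaleForce c f τ x, FluidPDE.nsRescale c u τ x⟫ =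
      c ^ 4 * (c ^ Module.finrank ℝ E)⁻¹ * (fun t => ∫ x, ⟪f t x, u t x⟫) (c ^ 2 * τ) := by
    intro τ
    have e2 : ∀ x, ⟪nsRescaleForce c f τ x, FluidPDE.nsRescale c u τ x⟫ =
        c ^ 4 * (fun y => ⟪f (c ^ 2 * τ) y, u (c ^ 2 * τ) y⟫) ((0 : E) + c • x) := by
      intro x
      simp only [nsRescaleForce_apply, nsRescale_apply, real_inner_smul_left, real_inner_smul_right,
        zero_add]
      ring
    simp_rw [e2]
    rw [integral_const_mul, integral_comp_space_affine hc (0 : E)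
      (fun y => ⟪f (c ^ 2 * τ) y, u (c ^ 2 * τ) y⟫), smul_eq_mul, mul_assoc]
  simp_rw [e1]
  have h3 := intervalIntegral.integral_comp_mul_left (fun t => ∫ x : E, ⟪f t x, u t x⟫)
    (pow_ne_zero 2 hc0) (a := a) (b := b)
  beta_reduce at h3
  rw [intervalIntegral.integral_const_mul, h3, smul_eq_mul]

/-- **The energy inequality under the parabolic scaling**: if
`E(u(c²b)) + ν ∫_{(c²a,c²b)} ∫|G|² ≤ A + ∫_{c²a}^{c²b} ∫⟪f, u⟫` then the rescaled triple satisfies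
`E(c u(c²b)(c ·)) + ν ∫_{(a,b)} ∫|c² G(c² ·)(c ·)|² ≤ c² c⁻ⁿ A + ∫ₐᵇ ∫⟪c³ f ∘ Φ, c u ∘ Φ⟫` (both
sides are `c² c⁻ⁿ` times the original ones; Caffarelli–Kohn–Nirenberg 1982, §1, (1.5)–(1.6)). [cite: CaffarelliKohnNirenberg1982, §1] -/
theorem energyIneq_nsRescale {c ν : ℝ} (hc : 0 < c) {f u : ℝ → E → E}
    {G : ℝ → E → E →L[ℝ] E} {a b A : ℝ}
    (h : VectorCalculus.kineticEnergy (u (c ^ 2 * b)) +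
      ν * (∫⁻ τ in Ioo (c ^ 2 * a) (c ^ 2 * b), ∫⁻ x,
        ENNReal.ofReal (frobeniusNormSq (G τ x))).toReal ≤
      A + ∫ τ in (c ^ 2 * a)..(c ^ 2 * b), ∫ x, ⟪f τ x, u τ x⟫) :
    VectorCalculus.kineticEnergy (FluidPDE.nsRescale c u b) +
      ν * (∫⁻ τ in Ioo a b, ∫⁻ x,
        ENNReal.ofReal (frobeniusNormSq (c ^ 2 • G (c ^ 2 * τ) (c • x)))).toReal ≤
      c ^ 2 * (c ^ Module.finrank ℝ E)⁻¹ * A +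
        ∫ τ in a..b, ∫ x, ⟪nsRescaleForce c f τ x, FluidPDE.nsRescale c u τ x⟫ := by
  have hc0 : c ≠ 0 := hc.ne'
  have hn : 0 < c ^ Module.finrank ℝ E := pow_pos hc _
  rw [nsRescale_slice, kineticEnergy_nsRescaleData hc, setLIntegral_frobeniusNormSq_nsRescaleGrad hc,
    intervalIntegral_forcing_nsRescale hc, ENNReal.toReal_mul, ENNReal.toReal_mul, ENNReal.toReal_mul,
    ENNReal.toReal_ofReal (by positivity), ENNReal.toReal_ofReal (inv_nonneg.2 hn.le),
    ENNReal.toReal_ofReal (inv_nonneg.2 (sq_nonneg c))]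
  set D := (∫⁻ τ in Ioo (c ^ 2 * a) (c ^ 2 * b), ∫⁻ x, ENNReal.ofReal (frobeniusNormSq (G τ x))).toReal
    with hD
  set W := ∫ τ in (c ^ 2 * a)..(c ^ 2 * b), ∫ x, ⟪f τ x, u τ x⟫ with hW
  have h2 := mul_le_mul_of_nonneg_left h (show 0 ≤ c ^ 2 * (c ^ Module.finrank ℝ E)⁻¹ by positivity)
  have e1 : ν * (c ^ 4 * (c ^ Module.finrank ℝ E)⁻¹ * ((c ^ 2)⁻¹ * D)) =
      c ^ 2 * (c ^ Module.finrank ℝ E)⁻¹ * (ν * D) := by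
    field_simp
  have e2 : c ^ 4 * (c ^ Module.finrank ℝ E)⁻¹ * ((c ^ 2)⁻¹ * W) =
      c ^ 2 * (c ^ Module.finrank ℝ E)⁻¹ * W := by
    field_simp
  rw [e1, e2, ← mul_add, ← mul_add]
  exact h2

end Energy

/-! ### Leray–Hopf solutions under the parabolic scaling -/

section LerayHopf

variable {E : Type*} [NormedAddCommGroup E] [InnerProductSpace ℝ E] [FiniteDimensional ℝ E]
  [MeasurableSpace E] [BorelSpace E]

/-- **The Navier–Stokes scaling of Leray–Hopf weak solutions** (Leray 1934, §20;
Caffarelli–Kohn–Nirenberg 1982, §1). If `u` is a Leray–Hopf weak solution on `E × [0, T)` with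
viscosity `ν`, force `f` and datum `u₀`, then for every `c > 0` the field `c u(c² ·, c ·)` is a
Leray–Hopf weak solution on `[0, T/c²)` with the same viscosity, force `c³ f(c² ·, c ·)` and datum
`c u₀(c ·)`: the weak formulation is `IsWeakNSSolutionOn.nsRescale`; the weak gradient rescales to
`s y ↦ c² G(c² s)(c y)`; both sides of each energy inequality pick up the factor `c² c⁻ⁿ`
(`energyIneq_nsRescale`); the `L^∞L²` bound picks up `c² c⁻ⁿ`; weak and strong `L²` continuity
are composed with `s ↦ c² s` (pairings against `w` become pairings against `w(c⁻¹ ·)`). [cite: Leray1934, §20] -/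
theorem isLerayHopfOn_nsRescale {T ν : ℝ} {f u : ℝ → E → E} {u₀ : E → E}
    (h : IsLerayHopfOn T ν f u₀ u) {c : ℝ} (hc : 0 < c) :
    IsLerayHopfOn (T / c ^ 2) ν (nsRescaleForce c f) (nsRescaleData c u₀) (FluidPDE.nsRescale c u) := by
  have hc2 : 0 < c ^ 2 := by positivity
  have hc0 : c ≠ 0 := hc.ne'
  have hn : 0 < c ^ Module.finrank ℝ E := pow_pos hc _
  have hmap := tendsto_mul_left_nhdsGT_zero hc2
  set κ : ℝ := c * (c ^ Module.finrank ℝ E)⁻¹ with hκ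
  refine
    { weak := h.weak.nsRescale hc
      energy_bound := ?_
      memLp := fun s hs => ?_
      weakGrad_energy := ?_
      weak_continuous := fun w hw => ?_
      strong_initial := ?_ }
  · -- `L^∞(0, T/c²; L²)`
    obtain ⟨C, hC⟩ := h.energy_bound
    refine ⟨Real.toNNReal (c ^ 2 * (c ^ Module.finrank ℝ E)⁻¹) * C, ?_⟩
    filter_upwards [ae_restrict_Ioo_div_comp_mul_left hc2 T hC] with s hs
    rw [nsRescale_slice, eEnergy_nsRescaleData hc, ENNReal.coe_mul,
      ← ENNReal.ofReal_mul (sq_nonneg c)]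
    exact mul_le_mul' le_rfl hs
  · -- every slice is in `L²`
    rw [nsRescale_slice]
    exact memLp_nsRescaleData (h.memLp (c ^ 2 * s) (mul_mem_Icc_zero_of_mem_Icc_div hc2 hs)) hc0
  · -- weak gradient `s y ↦ c² G(c² s)(c y)` and the two energy inequalities
    obtain ⟨G, hG, hGint, h0, hae⟩ := h.weakGrad_energy
    refine ⟨fun s x => c ^ 2 • G (c ^ 2 * s) (c • x), ?_, ?_, fun s hs => ?_, ?_⟩
    · filter_upwards [ae_restrict_Ioo_div_comp_mul_left hc2 T hG] with s hs
      exact hasWeakGradient_nsRescaleData hs hc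
    · rw [setLIntegral_frobeniusNormSq_nsRescaleGrad hc, mul_zero, mul_div_cancel_pos hc2]
      exact ENNReal.mul_lt_top (ENNReal.mul_lt_top ENNReal.ofReal_lt_top ENNReal.ofReal_lt_top)
        (ENNReal.mul_lt_top ENNReal.ofReal_lt_top hGint)
    · have h1 := h0 (c ^ 2 * s) (mul_mem_Icc_zero_of_mem_Icc_div hc2 hs)
      have h2 := energyIneq_nsRescale (a := 0) (A := VectorCalculus.kineticEnergy u₀) hc
        (f := f) (u := u) (G := G) (ν := ν) (b := s) (by rwa [mul_zero])
      rwa [← kineticEnergy_nsRescaleData hc] at h2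
    · have hae' : ∀ᵐ σ ∂(volume.restrict (Ioo 0 T)), ∀ t ∈ Icc σ T,
          VectorCalculus.kineticEnergy (u t) +
            ν * (∫⁻ τ in Ioo σ t, ∫⁻ x, ENNReal.ofReal (frobeniusNormSq (G τ x))).toReal ≤
          VectorCalculus.kineticEnergy (u σ) + ∫ τ in σ..t, ∫ x, ⟪f τ x, u τ x⟫ := hae
      filter_upwards [ae_restrict_Ioo_div_comp_mul_left hc2 T hae'] with s hs t hst
      have hct : c ^ 2 * t ∈ Icc (c ^ 2 * s) T :=
        ⟨mul_le_mul_of_nonneg_left hst.1 hc2.le, by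
          rw [mul_comm]; exact (le_div_iff₀ hc2).1 hst.2⟩
      have h2 := energyIneq_nsRescale (a := s) (A := VectorCalculus.kineticEnergy (u (c ^ 2 * s)))
        hc (f := f) (u := u) (G := G) (ν := ν) (b := t) (hs (c ^ 2 * t) hct)
      rwa [← kineticEnergy_nsRescaleData hc, ← nsRescale_slice] at h2
  · -- weak `L²` continuity on `(0, T/c²]` and the weak initial limit
    have hw' : MemLp (fun y => w (c⁻¹ • y)) 2 volume := memLp_comp_smul_of_ne_zero hw (inv_ne_zero hc0)
    obtain ⟨hcont, hlim⟩ := h.weak_continuous (fun y => w (c⁻¹ • y)) hw'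
    have e : (fun s => ∫ x, ⟪FluidPDE.nsRescale c u s x, w x⟫) =
        fun s => κ * ((fun t => ∫ y, ⟪u t y, w (c⁻¹ • y)⟫) (c ^ 2 * s)) := by
      funext s
      rw [nsRescale_slice, integral_inner_nsRescaleData hc]
    rw [e]
    refine ⟨continuousOn_const.mul
      (hcont.comp (continuous_const_mul (c ^ 2)).continuousOn (mapsTo_mul_Ioc_div hc2 T)), ?_⟩
    have h3 := (hlim.comp hmap).const_mul κ
    have e0 : ∫ x, ⟪nsRescaleData c u₀ x, w x⟫ = κ * ∫ y, ⟪u₀ y, w (c⁻¹ • y)⟫ :=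
      integral_inner_nsRescaleData hc u₀ w
    rw [e0]
    exact h3
  · -- the datum `c u₀(c ·)` is attained strongly in `L²`
    have e : (fun s => eLpNorm (FluidPDE.nsRescale c u s - nsRescaleData c u₀) 2 volume) =
        fun s => ‖c‖ₑ * ENNReal.ofReal |(c ^ Module.finrank ℝ E)⁻¹| ^ (1 / (2 : ℝ≥0∞)).toReal *
          ((fun t => eLpNorm (u t - u₀) 2 volume) (c ^ 2 * s)) := by
      funext s
      have hsub : FluidPDE.nsRescale c u s - nsRescaleData c u₀ =
          nsRescaleData c (u (c ^ 2 * s) - u₀) := by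
        funext x; simp [nsRescale_apply, nsRescaleData_apply, smul_sub]
      rw [hsub, eLpNorm_nsRescaleData_of_ne_zero 2 _ hc0]
    rw [e, ← mul_zero (‖c‖ₑ * ENNReal.ofReal |(c ^ Module.finrank ℝ E)⁻¹| ^ (1 / (2 : ℝ≥0∞)).toReal)]
    exact ENNReal.Tendsto.const_mul (h.strong_initial.comp hmap) (Or.inr (ENNReal.mul_ne_top
      enorm_ne_top (ENNReal.rpow_ne_top_of_nonneg (by positivity) ENNReal.ofReal_ne_top)))

/-- **Discharge of the named fact `IsLerayHopfOn.nsRescale`** (`SelfSimilar.lean`; Leray 1934,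
§20; Caffarelli–Kohn–Nirenberg 1982, §1): the Navier–Stokes scaling `c u(c² ·, c ·)` of a
Leray–Hopf weak solution on `[0, T)` is a Leray–Hopf weak solution on `[0, T/c²)` with force
`c³ f(c² ·, c ·)` and datum `c u₀(c ·)` (`isLerayHopfOn_nsRescale`). [cite: Leray1934, §20] -/
theorem IsLerayHopfOn.nsRescale_holds : IsLerayHopfOn.nsRescale (E := E) :=
  fun h _ hc => isLerayHopfOn_nsRescale h hc

end LerayHopf

end Literature.Analysis.FluidPDE

end
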